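import Summits.Ventures.HSemireg.WedgeHankelRecurrenceGaussRayleighQuotient

/-!
# Venture HSemireg — **THE MOMENT (HANKEL) DETERMINANTS AS GRAM DETERMINANTS: `det (s_{i+j})_{i,j≤n} = h_0 h_1 ⋯ h_n`** for a positive discrete measure with moments `s_p = Σ_l ν_l w_l^p` and
# orthogonal polynomials `q_0, …, q_n` (`h_k = Σ_l ν_l q_k(w_l)²`): the unit lower-triangular coefficient matrix `L = ([X^p] q_i)` gives `L H_n Lᵀ = diag(h)`; hence `det H_n = ∏ h_k > 0`,
# `h_n = det H_n ∕ det H_{n−1}`, and with the recurrence `det H_n = h_0^{n+1} ∏_{k≤n} b_1 ⋯ b_k`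

HONEST FRAMING. Part of the Lean index of the computation cell `pub-hsemireg` (seat p10 gen 43, Sunday typer «UNIFORM-IN-n»).  Real matrices (products, transposes, determinants), real polynomials
and finite sums only; no variety, no cohomology theory, no sheaf, no Ext group and no semiregularity map is constructed here; nothing here says that HC / HC_CM / HC_AV holds; no Literature fact
(unproved `Prop`) is declared or used.  Custodian versions as in `WedgeHankelSiegelIdeal` (1/3).
SOURCES (cited).  G. Szegő, *Orthogonal Polynomials*, (2.2.6)–(2.2.7) and (2.2.15) (the orthogonal polynomials and their norms through the moment determinants `D_n`; `h_n = D_n ∕ D_{n−1}`);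
T. S. Chihara, *An Introduction to Orthogonal Polynomials* (1978), Ch. I Thm 3.1–3.4 (`Δ_n > 0`) and Ex. 4.3; N. I. Akhiezer, *The Classical Moment Problem*, Ch. I §1 (Gram ∕ Hankel
determinants); F. R. Gantmacher, *The Theory of Matrices* I, Ch. IX §3 (Gram determinants).
PROOF TYPED HERE.  `H_n = Wᵀ diag(ν) W` with `W_{lp} = w_l^p` (`l < N`, `p ≤ n`), `L Wᵀ = E := (q_i(w_l))` (Mathlib `eval_eq_sum_range'`), so `L H_n Lᵀ = E diag(ν) Eᵀ = (Σ_l ν_l q_i(w_l) q_j(w_l)) =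
diag(h)` by orthogonality; `det L = 1` (monic, `[X^p] q_i = 0` for `p > i`; Mathlib `Matrix.det_of_lowerTriangular`).
DEDUP DISCLOSURE (`rg -n 'det_hankelSq_secSeq|hankelSq_secSeq_eq|gram' Summits/Ventures/HSemireg`, 2026-09-03): `SecantDeterminant` `det_hankelSq_secSeq` is the SQUARE case (`t + 1` atoms: `(∏ A) det V²`)
and N235-series `exists_moments_iff_posDef_hankelSq` is positivity; the Gram identity with the orthogonal polynomials for any number `N > n` of atoms is new.  The 7 names below: 0 hits tree-wide.

WHAT IS IN THE TREE.  `hankelSq` (CensusDet), `secSeq` (SecantRank); N273 `sum_mul_eval_sq_pos_of_natDegree_lt`; N279 `recurrence_monic_natDegree`; N299 `sum_sq_eq_prod_Ico_mul_sum_sq`; Mathlib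
`Polynomial.eval_eq_sum_range'`, `Fin.sum_univ_eq_sum_range`, `Matrix.det_of_lowerTriangular`, `Matrix.det_mul`, `Matrix.det_transpose`, `Matrix.det_diagonal`, `Matrix.transpose_mul`.
THIS FILE (namespace `Summit.Ventures.HSemireg.Wedge.HankelOuter` continued; CHAINED on N301 (import), N273, N279, N299; 0 definitions — `L`, `W`, `E` are inline `Matrix.of`):
* §1067 `hankelSq_secSeq_eq_transpose_mul` (`H_n = Wᵀ diag(ν) W`), `coeffMatrix_mul_powMatrix_transpose` (`L Wᵀ = E`), **`coeffMatrix_mul_hankelSq_mul_transpose`** (`L H_n Lᵀ = (Σ_l ν_l q_i(w_l) q_j(w_l))_{ij}`),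
  `det_coeffMatrix` (`det L = 1`), **`det_hankelSq_secSeq_eq_prod_norms`** (GRAM: `det H_n = ∏_{k≤n} h_k` for `(ν, w)`-orthogonal monic `q_0, …, q_n`), **`det_hankelSq_secSeq_pos_of_orthogonal`** (`> 0` for a
  positive measure with `N > n` atoms), `norm_eq_det_div_det` (`h_{n+1} = det H_{n+1} ∕ det H_n`), `det_hankelSq_secSeq_eq_prod_b` (with the recurrence: `det H_n = h_0^{n+1} ∏_{k≤n} ∏_{1≤l≤k} b_l`).
CAVEATS.  Discrete measures with finitely many atoms; `N > n` for positivity.  Nothing Ext-side.  New names only.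
-/

open Module Polynomial
open scoped Matrix Polynomial
open Summit.Ventures.HSemireg.Wedge.HankelSecant (secSeq)

namespace Summit.Ventures.HSemireg.Wedge.HankelOuter

/-! ## §1067. `det (s_{i+j})_{i,j ≤ n} = h_0 ⋯ h_n` -/

/-- **`H_n = Wᵀ diag(ν) W`** with `W_{lp} = w_l^p`: the moment matrix `(Σ_l ν_l w_l^{i+j})_{i,j≤n}` factors through the `N × (n+1)` power matrix. [Gantmacher IX §3; this file, §1067] -/
theorem hankelSq_secSeq_eq_transpose_mul {N n : ℕ} (ν w : Fin N → ℝ) :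
    hankelSq ℝ n (secSeq ℝ ν w) =
      (Matrix.of fun (l : Fin N) (p : Fin (n + 1)) => w l ^ (p : ℕ))ᵀ * Matrix.diagonal ν * Matrix.of fun (l : Fin N) (p : Fin (n + 1)) => w l ^ (p : ℕ) := by
  ext i j
  rw [Matrix.mul_apply]
  simp only [hankelSq, secSeq, Matrix.of_apply, Matrix.mul_diagonal, Matrix.transpose_apply, pow_add]
  exact Finset.sum_congr rfl fun l _ => by ring

/-- **`L Wᵀ = E`**: for `deg q_i ≤ n` (`i ≤ n`), `Σ_{p≤n} [X^p] q_i · w_l^p = q_i(w_l)`. [mechanism; this file, §1067] -/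
theorem coeffMatrix_mul_powMatrix_transpose {N n : ℕ} (w : Fin N → ℝ) {q : ℕ → ℝ[X]} (hdeg : ∀ k, k ≤ n → (q k).natDegree = k) :
    (Matrix.of fun (i p : Fin (n + 1)) => (q i).coeff p) * (Matrix.of fun (l : Fin N) (p : Fin (n + 1)) => w l ^ (p : ℕ))ᵀ =
      Matrix.of fun (i : Fin (n + 1)) (l : Fin N) => (q i).eval (w l) := by
  ext i l
  rw [Matrix.mul_apply, Matrix.of_apply, eval_eq_sum_range' (n := n + 1) (by rw [hdeg i (Nat.lt_succ_iff.1 i.isLt)]; exact i.isLt)]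
  simp only [Matrix.of_apply, Matrix.transpose_apply]
  exact Fin.sum_univ_eq_sum_range (fun p => (q i).coeff p * w l ^ p) (n + 1)

/-- **`L H_n Lᵀ = (Σ_l ν_l q_i(w_l) q_j(w_l))_{i,j}`** for the coefficient matrix `L_{ip} = [X^p] q_i` of polynomials with `deg q_i ≤ n`. [Szegő (2.2.6); Akhiezer I §1; this file, §1067] -/
theorem coeffMatrix_mul_hankelSq_mul_transpose {N n : ℕ} (ν w : Fin N → ℝ) {q : ℕ → ℝ[X]} (hdeg : ∀ k, k ≤ n → (q k).natDegree = k) :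
    (Matrix.of fun (i p : Fin (n + 1)) => (q i).coeff p) * hankelSq ℝ n (secSeq ℝ ν w) * (Matrix.of fun (i p : Fin (n + 1)) => (q i).coeff p)ᵀ =
      Matrix.of fun (i j : Fin (n + 1)) => ∑ l, ν l * ((q i).eval (w l) * (q j).eval (w l)) := by
  set L : Matrix (Fin (n + 1)) (Fin (n + 1)) ℝ := Matrix.of fun (i p : Fin (n + 1)) => (q i).coeff p with hL
  set W : Matrix (Fin N) (Fin (n + 1)) ℝ := Matrix.of fun (l : Fin N) (p : Fin (n + 1)) => w l ^ (p : ℕ) with hW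
  have hE : L * Wᵀ = Matrix.of fun (i : Fin (n + 1)) (l : Fin N) => (q i).eval (w l) := coeffMatrix_mul_powMatrix_transpose w hdeg
  have hET : W * Lᵀ = (Matrix.of fun (i : Fin (n + 1)) (l : Fin N) => (q i).eval (w l))ᵀ := by
    rw [← hE, Matrix.transpose_mul, Matrix.transpose_transpose]
  rw [hankelSq_secSeq_eq_transpose_mul, show L * (Wᵀ * Matrix.diagonal ν * W) * Lᵀ = (L * Wᵀ) * Matrix.diagonal ν * (W * Lᵀ) by simp only [Matrix.mul_assoc], hE, hET]
  ext i j
  rw [Matrix.mul_apply, Matrix.of_apply]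
  simp only [Matrix.mul_diagonal, Matrix.of_apply, Matrix.transpose_apply]
  exact Finset.sum_congr rfl fun l _ => by ring

/-- **`det L = 1`** for the coefficient matrix of monic `q_0, …, q_n` with `deg q_i = i` (unit lower triangular). [mechanism; this file, §1067] -/
theorem det_coeffMatrix {n : ℕ} {q : ℕ → ℝ[X]} (hmonic : ∀ k, k ≤ n → (q k).Monic) (hdeg : ∀ k, k ≤ n → (q k).natDegree = k) :
    (Matrix.of fun (i p : Fin (n + 1)) => (q i).coeff p).det = 1 := by
  rw [Matrix.det_of_lowerTriangular]
  · refine Finset.prod_eq_one fun i _ => ?_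
    rw [Matrix.of_apply]
    have h := (hmonic i (Nat.lt_succ_iff.1 i.isLt)).coeff_natDegree
    rwa [hdeg i (Nat.lt_succ_iff.1 i.isLt)] at h
  · intro i j hij
    rw [Matrix.of_apply]
    exact coeff_eq_zero_of_natDegree_lt (by rw [hdeg i (Nat.lt_succ_iff.1 i.isLt)]; exact hij)

/-- **GRAM IDENTITY: `det (Σ_l ν_l w_l^{i+j})_{i,j≤n} = ∏_{k≤n} h_k`** for monic `q_0, …, q_n` with `deg q_k = k`, pairwise `(ν, w)`-orthogonal (`Σ_l ν_l q_i(w_l) q_j(w_l) = 0`, `i ≠ j`), `h_k = Σ_l ν_l q_k(w_l)²`.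
[Szegő (2.2.7) + (2.2.15); Chihara I Ex. 4.3; this file, §1067] -/
theorem det_hankelSq_secSeq_eq_prod_norms {N n : ℕ} (ν w : Fin N → ℝ) {q : ℕ → ℝ[X]} (hmonic : ∀ k, k ≤ n → (q k).Monic) (hdeg : ∀ k, k ≤ n → (q k).natDegree = k)
    (hpair : ∀ i j, i ≤ n → j ≤ n → i ≠ j → ∑ l, ν l * ((q i).eval (w l) * (q j).eval (w l)) = 0) :
    (hankelSq ℝ n (secSeq ℝ ν w)).det = ∏ k : Fin (n + 1), ∑ l, ν l * ((q k).eval (w l)) ^ 2 := by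
  have h := congrArg Matrix.det (coeffMatrix_mul_hankelSq_mul_transpose ν w hdeg)
  rw [Matrix.det_mul, Matrix.det_mul, Matrix.det_transpose, det_coeffMatrix hmonic hdeg, one_mul, mul_one] at h
  rw [h]
  have hdiag : (Matrix.of fun (i j : Fin (n + 1)) => ∑ l, ν l * ((q i).eval (w l) * (q j).eval (w l))) = Matrix.diagonal fun k : Fin (n + 1) => ∑ l, ν l * ((q k).eval (w l)) ^ 2 := by
    ext i j
    rw [Matrix.of_apply, Matrix.diagonal_apply]
    split_ifs with hij
    · rw [hij]; exact Finset.sum_congr rfl fun l _ => by rw [sq]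
    · exact hpair i j (Nat.lt_succ_iff.1 i.isLt) (Nat.lt_succ_iff.1 j.isLt) (fun h => hij (Fin.ext h))
  rw [hdiag, Matrix.det_diagonal]

/-- **`det (s_{i+j})_{i,j≤n} > 0`** for a positive discrete measure with `N > n` atoms (via its orthogonal polynomials, N289). [Chihara I Thm 3.4; Hamburger 1920; this file, §1067] -/
theorem det_hankelSq_secSeq_pos_of_orthogonal {N n : ℕ} {ν w : Fin N → ℝ} (hν : ∀ l, 0 < ν l) (hw : Function.Injective w) (hnN : n < N) {q : ℕ → ℝ[X]}
    (hmonic : ∀ k, k ≤ n → (q k).Monic) (hdeg : ∀ k, k ≤ n → (q k).natDegree = k)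
    (hpair : ∀ i j, i ≤ n → j ≤ n → i ≠ j → ∑ l, ν l * ((q i).eval (w l) * (q j).eval (w l)) = 0) :
    0 < (hankelSq ℝ n (secSeq ℝ ν w)).det := by
  rw [det_hankelSq_secSeq_eq_prod_norms ν w hmonic hdeg hpair]
  exact Finset.prod_pos fun k _ => sum_mul_eval_sq_pos_of_natDegree_lt hν hw (hmonic k (Nat.lt_succ_iff.1 k.isLt)).ne_zero (by rw [hdeg k (Nat.lt_succ_iff.1 k.isLt)]; omega)

/-- **`h_{n+1} = det H_{n+1} ∕ det H_n`** (Szegő (2.2.15)). [Szegő (2.2.15); Chihara I Ex. 4.3; this file, §1067] -/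
theorem norm_eq_det_div_det {N n : ℕ} {ν w : Fin N → ℝ} (hν : ∀ l, 0 < ν l) (hw : Function.Injective w) (hnN : n < N) {q : ℕ → ℝ[X]}
    (hmonic : ∀ k, k ≤ n + 1 → (q k).Monic) (hdeg : ∀ k, k ≤ n + 1 → (q k).natDegree = k)
    (hpair : ∀ i j, i ≤ n + 1 → j ≤ n + 1 → i ≠ j → ∑ l, ν l * ((q i).eval (w l) * (q j).eval (w l)) = 0) :
    ∑ l, ν l * ((q (n + 1)).eval (w l)) ^ 2 = (hankelSq ℝ (n + 1) (secSeq ℝ ν w)).det / (hankelSq ℝ n (secSeq ℝ ν w)).det := by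
  have hpos := det_hankelSq_secSeq_pos_of_orthogonal hν hw hnN (fun k hk => hmonic k (by omega)) (fun k hk => hdeg k (by omega)) (fun i j hi hj hij => hpair i j (by omega) (by omega) hij)
  rw [eq_div_iff hpos.ne', det_hankelSq_secSeq_eq_prod_norms ν w hmonic hdeg hpair,
    det_hankelSq_secSeq_eq_prod_norms ν w (fun k hk => hmonic k (by omega)) (fun k hk => hdeg k (by omega)) (fun i j hi hj hij => hpair i j (by omega) (by omega) hij),
    Fin.prod_univ_castSucc (n := n + 1)]
  simp only [Fin.val_castSucc, Fin.val_last]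
  ring

/-- **With the recurrence: `det H_n = h_0^{n+1} · ∏_{k≤n} (b_1 ⋯ b_k)`** (`h_0 = Σ_l ν_l`), for the orthogonal polynomials of a positive discrete measure obeying `q_{k+2} = (X − a_{k+1}) q_{k+1} − b_{k+1} q_k`.
[Chihara I Thm 4.2 (c) + Ex. 4.3; this file, §1067] -/
theorem det_hankelSq_secSeq_eq_prod_b {N n : ℕ} {ν w : Fin N → ℝ} {q : ℕ → ℝ[X]} {a b : ℕ → ℝ} (hq0 : q 0 = 1) (hq1 : q 1 = Polynomial.X - C (a 0))
    (hrec : ∀ n, q (n + 2) = (Polynomial.X - C (a (n + 1))) * q (n + 1) - C (b (n + 1)) * q n)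
    (horth : ∀ k, k ≤ n + 1 → ∀ G : ℝ[X], G.natDegree < k → ∑ l, ν l * (q k * G).eval (w l) = 0) :
    (hankelSq ℝ n (secSeq ℝ ν w)).det = (∑ l, ν l) ^ (n + 1) * ∏ k : Fin (n + 1), ∏ j ∈ Finset.Ico 1 ((k : ℕ) + 1), b j := by
  have hmd := recurrence_monic_natDegree hq0 hq1 hrec
  -- pairwise orthogonality from lower orthogonality
  have hpair : ∀ i j, i ≤ n → j ≤ n → i ≠ j → ∑ l, ν l * ((q i).eval (w l) * (q j).eval (w l)) = 0 := by
    intro i j hi hj hij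
    rcases lt_or_gt_of_ne hij with h | h
    · have := horth j (by omega) (q i) (by rw [(hmd i).2]; exact h)
      rw [← this]; exact Finset.sum_congr rfl fun l _ => by rw [eval_mul, mul_comm ((q i).eval _)]
    · have := horth i (by omega) (q j) (by rw [(hmd j).2]; exact h)
      rw [← this]; exact Finset.sum_congr rfl fun l _ => by rw [eval_mul]
  rw [det_hankelSq_secSeq_eq_prod_norms ν w (fun k _ => (hmd k).1) (fun k _ => (hmd k).2) hpair]
  have h0 : ∑ l, ν l * ((q 0).eval (w l)) ^ 2 = ∑ l, ν l := Finset.sum_congr rfl fun l _ => by rw [hq0, eval_one, one_pow, mul_one]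
  have hk : ∀ k : Fin (n + 1), ∑ l, ν l * ((q k).eval (w l)) ^ 2 = (∏ j ∈ Finset.Ico 1 ((k : ℕ) + 1), b j) * ∑ l, ν l := fun k => by
    rw [← h0]; exact sum_sq_eq_prod_Ico_mul_sum_sq hq0 hq1 hrec horth (Nat.zero_le _) (by have := k.isLt; omega)
  simp only [hk]
  rw [Finset.prod_mul_distrib, Finset.prod_const, Finset.card_univ, Fintype.card_fin, mul_comm]

end Summit.Ventures.HSemireg.Wedge.HankelOuter
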